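import Literature.Analysis.FunctionSpaces.LittlewoodPaleyMultiplierProofs
import Literature.Analysis.FunctionSpaces.HomogeneousSymbolBounds
import HarnessLib

/-!
# The elliptic block estimate for the Laplacian: `‖Δ̇_j u‖_{L^p} ≤ C 2^{-2j} ‖Δ̇_j Δu‖_{L^p}` (Schauder program, item A′1)

Topic `Literature/Analysis/FunctionSpaces`. The converse of the Bernstein bound
`exists_eHomBesovNorm_laplacian_le` (`‖Δu‖_{Ḃ^{s-2}} ≤ C‖u‖_{Ḃ^s}`): on each dyadic block the
Laplacian is invertible with the expected gain, because the parametrix symbol `σ(ξ) = 1/‖ξ‖²` is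
smooth off the origin and positively homogeneous of degree `−2`, so that the block multiplier
theorem (`exists_eLpNormDistrib_truncSymbol_lpBlock_le`, Bahouri–Chemin–Danchin 2011, Lemma 2.2)
applies with the Mikhlin constants of `HomogeneousSymbolBounds.lean`; the algebraic identity is
`σ_j(D) Δ̇_j(Δ u) = -(2π)² Δ̇_j u` (`Δ = -(2π)² |D|²`, `|ξ|² σ(ξ) ψ_j(ξ) = ψ_j(ξ)`,
`ψ_j(D) Δ̇_j = Δ̇_j`).

* `exists_eLpNormDistrib_lpBlock_le_laplacian` — `‖Δ̇_j u‖_{L^p} ≤ C 2^{-2j} ‖Δ̇_j (Δ u)‖_{L^p}`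
  for all `j ∈ ℤ`, `u ∈ 𝓢'(E, F)`, `1 ≤ p ≤ ∞`;
* `exists_eHomBesovNorm_le_laplacian` — `‖u‖_{Ḃ^{s+2}_{p,q}} ≤ C ‖Δ u‖_{Ḃ^s_{p,q}}`
  (BCD Prop. 2.30-type ellipticity of `Δ` on homogeneous Besov spaces).

For `p = q = ∞`, `s = α` this is the Fourier-side core of the constant-coefficient Schauder
estimate `‖D²u‖_{C^{0,α}} ≲ ‖Δu‖_{C^{0,α}} + ‖u‖_∞` (Gilbarg–Trudinger 2001, Thm. 4.8 / Cor. 4.9),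
census item (2a) of `Literature.Geometry.Riemannian.gurskyViaclovsky_pathOpen_weighted_four`.
Everything is proved; no named facts.

## References

* H. Bahouri, J.-Y. Chemin, R. Danchin, *Fourier Analysis and Nonlinear PDE* (2011), Lemma 2.2,
  Prop. 2.30. [BahouriCheminDanchin2011]
* D. Gilbarg, N. S. Trudinger, *Elliptic Partial Differential Equations of Second Order* (2001),
  Thm. 4.8. [GilbargTrudinger2001]
-/

noncomputable section

open MeasureTheory TemperedDistribution SchwartzMap Filter Topology Function
open scoped SchwartzMap ENNReal NNReal FourierTransform Real ContDiff
open scoped LineDeriv Laplacian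

namespace Literature.Analysis.FunctionSpaces

variable {E : Type*} [NormedAddCommGroup E] [InnerProductSpace ℝ E] [FiniteDimensional ℝ E]
  [MeasurableSpace E] [BorelSpace E] {F : Type*} [NormedAddCommGroup F] [NormedSpace ℂ F]
  [CompleteSpace F]

/-- The parametrix symbol `σ(ξ) = 1/‖ξ‖²` (complex-valued), as local notation (no definition is
introduced). -/
local notation "invNormSq" => (fun ξ : E => (((‖ξ‖ ^ 2)⁻¹ : ℝ) : ℂ))

omit [FiniteDimensional ℝ E] [MeasurableSpace E] [BorelSpace E] in
/-- `1/‖ξ‖²` is smooth off the origin. [folklore] -/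
private theorem contDiffOn_invNormSq : ContDiffOn ℝ ∞ invNormSq {0}ᶜ := by
  refine Complex.ofRealCLM.contDiff.comp_contDiffOn ?_
  refine ((contDiff_norm_sq ℝ).contDiffOn.inv fun ξ hξ => ?_)
  exact pow_ne_zero 2 (norm_ne_zero_iff.2 hξ)

omit [FiniteDimensional ℝ E] [MeasurableSpace E] [BorelSpace E] in
/-- `1/‖ξ‖²` is positively homogeneous of degree `−2`. [folklore] -/
private theorem invNormSq_smul {t : ℝ} (ht : 0 < t) (ξ : E) (_hξ : ξ ≠ 0) :
    invNormSq (t • ξ) = t ^ (-2 : ℤ) • invNormSq ξ := by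
  show (((‖t • ξ‖ ^ 2)⁻¹ : ℝ) : ℂ) = t ^ (-2 : ℤ) • (((‖ξ‖ ^ 2)⁻¹ : ℝ) : ℂ)
  simp only [norm_smul, Real.norm_eq_abs, abs_of_pos ht, mul_pow, mul_inv, zpow_neg,
    zpow_ofNat, Complex.real_smul, Complex.ofReal_mul, Complex.ofReal_inv, Complex.ofReal_pow]

omit [MeasurableSpace E] [BorelSpace E] in
/-- Mikhlin bounds for `1/‖ξ‖²` (`m = -2`). [cite: BahouriCheminDanchin2011, Lemma 2.2] -/
private theorem exists_mikhlin_invNormSq :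
    ∃ C : ℕ → ℝ, ∀ (N : ℕ) (ξ : E), ξ ≠ 0 →
      ‖iteratedFDeriv ℝ N invNormSq ξ‖ ≤ C N * ‖ξ‖ ^ ((-2 : ℝ) - N) := by
  have h := exists_mikhlin_bound_of_homogeneous (contDiffOn_invNormSq (E := E)) (m := -2)
    (fun t ht ξ hξ => invNormSq_smul ht ξ hξ)
  simpa only [Int.cast_neg, Int.cast_ofNat] using h

omit [FiniteDimensional ℝ E] [MeasurableSpace E] [BorelSpace E] [CompleteSpace F] in
/-- The symbol identity `‖ξ‖² · σ_j(ξ) = ψ_j(ξ)` (`σ = 1/‖ξ‖²`, `ψ_j = ψ(2^{-j}·)` vanishing at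
`0`). [folklore] -/
private theorem normSq_mul_truncSymbol_invNormSq (j : ℤ) :
    ((fun x : E => ((‖x‖ ^ 2 : ℝ) : ℂ)) * truncSymbol invNormSq j) =
      fun ξ : E => bernsteinSymbol (((2 : ℝ) ^ (-j)) • ξ) := by
  funext ξ
  simp only [Pi.mul_apply, truncSymbol_apply]
  by_cases hξ : ξ = 0
  · subst hξ
    have h0 : bernsteinSymbol (((2 : ℝ) ^ (-j)) • (0 : E)) = 0 := by
      rw [smul_zero]
      exact bernsteinSymbol_eq_zero_of_norm_le (by simp)
    simp only [h0, mul_zero]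
  · have hn : (‖ξ‖ ^ 2 : ℝ) ≠ 0 := pow_ne_zero 2 (norm_ne_zero_iff.2 hξ)
    rw [← mul_assoc, ← Complex.ofReal_mul, mul_inv_cancel₀ hn, Complex.ofReal_one, one_mul]

omit [CompleteSpace F] in
/-- **The parametrix identity on a block**: `σ_j(D) Δ̇_j (Δ u) = -(2π)² Δ̇_j u`. [folklore] -/
theorem fourierMultiplierCLM_truncSymbol_invNormSq_lpBlock_laplacian (j : ℤ) (u : 𝓢'(E, F)) :
    fourierMultiplierCLM F (truncSymbol (fun ξ : E => (((‖ξ‖ ^ 2)⁻¹ : ℝ) : ℂ)) j) (lpBlock j (Δ u)) =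
      (-(2 * π) ^ 2 : ℝ) • lpBlock j u := by
  have hg : (fun x : E => ((‖x‖ ^ 2 : ℝ) : ℂ)).HasTemperateGrowth := by fun_prop
  have hσ : (truncSymbol invNormSq j).HasTemperateGrowth :=
    hasTemperateGrowth_truncSymbol contDiffOn_invNormSq j
  rw [lpBlock_laplacian_comm, TemperedDistribution.laplacian_eq_fourierMultiplierCLM,
    ContinuousLinearMap.map_smul_of_tower,
    TemperedDistribution.fourierMultiplierCLM_fourierMultiplierCLM_apply hg hσ,
    normSq_mul_truncSymbol_invNormSq, ← lpBlock_eq_fourierMultiplierCLM_bernsteinSymbol_rescaled]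

/-- **The elliptic block estimate for the Laplacian**: for `1 ≤ p ≤ ∞` there is `C` with
`‖Δ̇_j u‖_{L^p} ≤ C 2^{-2j} ‖Δ̇_j (Δ u)‖_{L^p}` for all `j ∈ ℤ` and `u ∈ 𝓢'(E, F)` (the block
multiplier theorem for the parametrix symbol `1/‖ξ‖²`). [cite: BahouriCheminDanchin2011, Lemma 2.2] -/
theorem exists_eLpNormDistrib_lpBlock_le_laplacian (p : ℝ≥0∞) [Fact (1 ≤ p)] :
    ∃ C : ℝ≥0, ∀ (j : ℤ) (u : 𝓢'(E, F)),
      eLpNormDistrib p (lpBlock j u) ≤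
        C * (2 : ℝ≥0∞) ^ ((j : ℝ) * (-2)) * eLpNormDistrib p (lpBlock j (Δ u)) := by
  obtain ⟨Cσ, hCσ⟩ := exists_mikhlin_invNormSq (E := E)
  obtain ⟨C, hC⟩ := exists_eLpNormDistrib_truncSymbol_lpBlock_le (E := E) (F := F) p
    contDiffOn_invNormSq (m := -2) hCσ
  -- the constant `c = (-(2π)²)⁻¹`
  set c : ℝ := (-(2 * π) ^ 2 : ℝ)⁻¹ with hc
  have hc0 : (-(2 * π) ^ 2 : ℝ) ≠ 0 := by
    have : (0 : ℝ) < (2 * π) ^ 2 := by positivity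
    linarith
  have hcC : (c : ℂ) ≠ 0 := by
    rw [Ne, Complex.ofReal_eq_zero, hc]
    exact inv_ne_zero hc0
  refine ⟨‖(c : ℂ)‖₊ * C, fun j u => ?_⟩
  -- `Δ̇_j u = c • σ_j(D) Δ̇_j (Δ u)`
  have hid : lpBlock j u = (c : ℂ) • fourierMultiplierCLM F (truncSymbol invNormSq j)
      (lpBlock j (Δ u)) := by
    have h := fourierMultiplierCLM_truncSymbol_invNormSq_lpBlock_laplacian j u
    rw [h, Complex.coe_smul, smul_smul, hc, inv_mul_cancel₀ hc0, one_smul]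
  rw [hid, eLpNormDistrib_const_smul hcC, ENNReal.coe_mul, mul_assoc, mul_assoc]
  gcongr
  · exact le_of_eq (enorm_eq_nnnorm _)
  · rw [← mul_assoc]
    exact hC j (Δ u)

/-- **Ellipticity of `Δ` on the homogeneous Besov scale**: for `1 ≤ p ≤ ∞` there is `C` with
`‖u‖_{Ḃ^{s+2}_{p,q}} ≤ C ‖Δ u‖_{Ḃ^s_{p,q}}` for all `s`, `q`, `u ∈ 𝓢'(E, F)`.
[cite: BahouriCheminDanchin2011, Prop. 2.30] -/
theorem exists_eHomBesovNorm_le_laplacian (p : ℝ≥0∞) [Fact (1 ≤ p)] :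
    ∃ C : ℝ≥0, ∀ (s : ℝ) (q : ℝ≥0∞) (u : 𝓢'(E, F)),
      eHomBesovNorm (s + 2) p q u ≤ C * eHomBesovNorm s p q (Δ u) := by
  obtain ⟨C, hC⟩ := exists_eLpNormDistrib_lpBlock_le_laplacian (E := E) (F := F) p
  refine ⟨C, fun s q u => ?_⟩
  have hfac : ∀ j : ℤ, lpBlockWeight (s + 2) p u j ≤ (C : ℝ≥0∞) * lpBlockWeight s p (Δ u) j := by
    intro j
    simp only [lpBlockWeight]
    calc (2 : ℝ≥0∞) ^ ((j : ℝ) * (s + 2)) * eLpNormDistrib p (lpBlock j u)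
        ≤ (2 : ℝ≥0∞) ^ ((j : ℝ) * (s + 2)) *
            (C * (2 : ℝ≥0∞) ^ ((j : ℝ) * (-2)) * eLpNormDistrib p (lpBlock j (Δ u))) := by
          gcongr
          exact hC j u
      _ = C * ((2 : ℝ≥0∞) ^ ((j : ℝ) * (s + 2)) * (2 : ℝ≥0∞) ^ ((j : ℝ) * (-2)) *
            eLpNormDistrib p (lpBlock j (Δ u))) := by ring
      _ = C * ((2 : ℝ≥0∞) ^ ((j : ℝ) * s) * eLpNormDistrib p (lpBlock j (Δ u))) := by
          rw [two_rpow_mul_two_rpow, show (j : ℝ) * (s + 2) + (j : ℝ) * (-2) = (j : ℝ) * s by ring]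
  unfold eHomBesovNorm
  refine eLpNorm_le_mul_eLpNorm_of_ae_le_mul' (ae_of_all _ fun j => ?_) q
  simpa only [enorm_eq_self] using hfac j

end Literature.Analysis.FunctionSpaces

end
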